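import Summits.MatrixMultiplication.MatrixMultiplication.Theorems.SubgroupIdentityDesigns.Negative.PackingBridge
import Summits.MatrixMultiplication.MatrixMultiplication.Theorems.SubgroupIdentityDesigns.Negative.GradedPlancherel

/-!
# Volume-ratio law: a witness's volume beats the level dimension in the crux's own exponent
(negative-side lemma for the crux `SubgroupIdentityDesigns`, stmt-MatrixMultiplication-14079; VALUE = a theorem
about hypothetical witnesses and the formal payoff of the census conjecture (V2) below — NOT summit progress; the
crux item stays open)

For a two-sided-invariant test space `J ≤ ℂ[G]` the block decomposition gives
`dim J ≤ Σ_{χ ∈ Irr(G) ∩ J} χ(1)^s` for every `s ≥ 2` (the tree's graded Plancherel inequality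
`GradedPlancherel.finrank_le_gradedBudget`), so `dim J ≤ budget_{2+ε}(J)` for every `ε ≥ 0`.  Hence the strict inequality of the crux ALONE (no TPP and no design clause needed) forces

  `dim F_k|_{GL_m(𝔽_p)} < V^{(2+ε)/3}`, i.e. `V > D_k^{3/(2+ε)}`        (`finrank_lt_volume_rpow`),

the `N`-free form of the witness shell `D_k³ < N^{3ε/(2+ε)} V²` of `WitnessShell` (take `N ≤ D_k`).  Together
with a VOLUME-RATIO hypothesis `V ≤ C · D_k` it gives the **volume-ratio law**

  `(1 − ε) · log D_k < (2 + ε) · log C`                                  (`volume_ratio_law`):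

a witness at `ε < 1` whose volume is at most `C` times the level dimension lives in a level space of dimension
`D_k < C^{(2+ε)/(1−ε)}`.  Every complete census of subgroup-TPP level-`k` identity designs recorded so far (the
disprover's kit censuses in `Cruxes/SubgroupIdentityDesigns/Disproof.lean`: `GL_2(𝔽_5)` level 1, `V = 160`,
`D_1 = 134`; `GL_3(𝔽_2)` level 2, `V ≤ 288`, `D_2 = 150`; cell b2b-lgcu-borel gens 5/11/12: `GL_2(𝔽_p)`,
`p ≤ 13`, level 1; `GL_3(𝔽_2)` levels 1–2 with exact certificates; Family A with `V/D_1 → 2⁻`) has `V < 2·D_k`.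
The census conjecture **(V2)** "`V ≤ 2·D_k` for every subgroup-TPP triple of `GL_m(𝔽_p)` carrying a level-`k`
identity design, `k < m`" would therefore confine every witness at `ε ≤ 1/4` to level spaces of dimension
`D_k < 8` (`no_witness_of_volume_le_two_mul`) — which the class-number laws of `ClassNumberLaws`
(`k·log p > 66·log 2` at `ε ≤ 1/100`) exclude.  (V2) is NOT proved here: this file only turns its payoff into a
theorem, so that a census counterexample (`V ≥ 2 D_k`) or a proof of (V2) is immediately priced.
-/

set_option linter.dupNamespace false

noncomputable section

open scoped BigOperators Classical
open Module Literature.RepresentationTheory.FiniteGroups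
open Literature.Barriers.MatrixMultiplication (SubgroupTPP)

namespace Summit.MatrixMultiplication.MatrixMultiplication.Theorems.SubgroupIdentityDesigns.Negative
namespace VolumeRatioLaw

open Summit.MatrixMultiplication.MatrixMultiplication.Theorems.LieRankDesigns.Negative
open Summit.MatrixMultiplication.MatrixMultiplication.Theorems.LevelOneGL2Designs.Negative
open Summit.MatrixMultiplication.MatrixMultiplication.Theorems.GradedDesignFamily.Negative

/-! ## Abstract form: any finite group, any two-sided-invariant test space -/

section Abstract

variable {G : Type} [Group G] [Fintype G]

/-- If the graded budget `budget_{2+ε}(J)` is `< W` (`ε ≥ 0`) then `dim J < W` — no TPP and no design needed;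
from the tree's graded Plancherel inequality `dim J ≤ Σ_{χ ∈ Irr ∩ J} χ(1)^s` (`GradedPlancherel.lean`,
`finrank_le_gradedBudget`, `s = 2 + ε ≥ 2`). [folklore] -/
theorem finrank_lt_of_gradedBudget_lt (J : Submodule ℂ (G → ℂ))
    (hJ : ∀ f ∈ J, ∀ a b : G, (fun g : G => f (a * g * b)) ∈ J) {ε W : ℝ} (hε : 0 ≤ ε)
    (hlt : (∑ᶠ χ ∈ irrChars G ∩ (J : Set (G → ℂ)), (χ 1).re ^ ((2 + ε : ℝ))) < W) :
    (finrank ℂ J : ℝ) < W :=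
  (finrank_le_gradedBudget J hJ (show (2 : ℝ) ≤ 2 + ε by linarith)).trans_lt hlt

/-- **Volume-ratio law (abstract).**  If `budget_{2+ε}(J) < V^{(2+ε)/3}` and `V ≤ C · dim J` with `C > 0`,
`0 ≤ ε`, then `(1 − ε) log (dim J) < (2 + ε) log C`. [folklore] -/
theorem ratio_law (J : Submodule ℂ (G → ℂ))
    (hJ : ∀ f ∈ J, ∀ a b : G, (fun g : G => f (a * g * b)) ∈ J) {ε C V : ℝ} (hε : 0 ≤ ε) (hC : 0 < C)
    (hV0 : 0 ≤ V) (hV : V ≤ C * (finrank ℂ J : ℝ))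
    (hlt : (∑ᶠ χ ∈ irrChars G ∩ (J : Set (G → ℂ)), (χ 1).re ^ ((2 + ε : ℝ))) < V ^ ((2 + ε) / 3)) :
    (1 - ε) * Real.log (finrank ℂ J : ℝ) < (2 + ε) * Real.log C := by
  set D : ℝ := (finrank ℂ J : ℝ) with hDdef
  have hD0 : 0 ≤ D := by positivity
  have ha : 0 < (2 + ε) / 3 := by positivity
  have h1 : D < V ^ ((2 + ε) / 3) := finrank_lt_of_gradedBudget_lt J hJ hε hlt
  have hVpos : 0 < V := by
    rcases hV0.lt_or_eq with h | h
    · exact h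
    · rw [← h, Real.zero_rpow ha.ne'] at h1
      exact absurd h1 (not_lt.2 hD0)
  have hDpos : 0 < D := by nlinarith [hV, hVpos, hC]
  have h2 : Real.log D < (2 + ε) / 3 * Real.log V := by
    rw [← Real.log_rpow hVpos]
    exact Real.log_lt_log hDpos h1
  have h3 : Real.log V ≤ Real.log C + Real.log D := by
    rw [← Real.log_mul hC.ne' hDpos.ne']
    exact Real.log_le_log hVpos hV
  have h4 : Real.log D < (2 + ε) / 3 * (Real.log C + Real.log D) :=
    h2.trans_le (mul_le_mul_of_nonneg_left h3 ha.le)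
  nlinarith [h4, hε]

end Abstract

/-! ## The crux's literal terms: `G = GL_m(𝔽_p)`, `J = F_k|_G`, `V = |H₁| |H₂| |H₃|` -/

section Crux

variable {p m k : ℕ} [hp : Fact p.Prime]

/-- **`V > D_k^{3/(2+ε)}`**: the strict inequality of the crux alone forces the volume to beat the level dimension
in the crux's own exponent: `dim F_k|_{GL_m(𝔽_p)} < (|H₁| |H₂| |H₃|)^{(2+ε)/3}`. [folklore] -/
theorem finrank_lt_volume_rpow {ε : ℝ} (hε : 0 ≤ ε) {H₁ H₂ H₃ : Subgroup (GLm p m)}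
    (hlt : budget p m k (2 + ε) <
      ((Nat.card H₁ * Nat.card H₂ * Nat.card H₃ : ℕ) : ℝ) ^ ((2 + ε) / 3)) :
    (finrank ℂ (levelSubmodule p m k) : ℝ) <
      ((Nat.card H₁ * Nat.card H₂ * Nat.card H₃ : ℕ) : ℝ) ^ ((2 + ε) / 3) :=
  finrank_lt_of_gradedBudget_lt (levelSubmodule p m k) levelSubmodule_bi_inv hε
    (by rwa [← PackingBridge.budget_eq])

/-- **VOLUME-RATIO LAW FOR THE CRUX.**  A witness of the strict inequality of `SubgroupIdentityDesigns` at
`ε ≥ 0` whose volume satisfies `|H₁| |H₂| |H₃| ≤ C · dim F_k|_{GL_m(𝔽_p)}` (`C > 0`) has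
`(1 − ε) · log dim F_k < (2 + ε) · log C`. [folklore] -/
theorem volume_ratio_law {ε C : ℝ} (hε : 0 ≤ ε) (hC : 0 < C) {H₁ H₂ H₃ : Subgroup (GLm p m)}
    (hV : ((Nat.card H₁ * Nat.card H₂ * Nat.card H₃ : ℕ) : ℝ) ≤ C * (finrank ℂ (levelSubmodule p m k) : ℝ))
    (hlt : budget p m k (2 + ε) <
      ((Nat.card H₁ * Nat.card H₂ * Nat.card H₃ : ℕ) : ℝ) ^ ((2 + ε) / 3)) :
    (1 - ε) * Real.log (finrank ℂ (levelSubmodule p m k) : ℝ) < (2 + ε) * Real.log C :=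
  ratio_law (levelSubmodule p m k) levelSubmodule_bi_inv hε hC (by positivity) hV
    (by rwa [← PackingBridge.budget_eq])

/-- Contrapositive: if `V ≤ C · D_k` and `(2 + ε) log C ≤ (1 − ε) log D_k` then the strict inequality of the crux
fails for this triple at this `ε`. [folklore] -/
theorem no_witness_of_volume_le_mul {ε C : ℝ} (hε : 0 ≤ ε) (hC : 0 < C) {H₁ H₂ H₃ : Subgroup (GLm p m)}
    (hV : ((Nat.card H₁ * Nat.card H₂ * Nat.card H₃ : ℕ) : ℝ) ≤ C * (finrank ℂ (levelSubmodule p m k) : ℝ))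
    (hD : (2 + ε) * Real.log C ≤ (1 - ε) * Real.log (finrank ℂ (levelSubmodule p m k) : ℝ)) :
    ¬ budget p m k (2 + ε) <
      ((Nat.card H₁ * Nat.card H₂ * Nat.card H₃ : ℕ) : ℝ) ^ ((2 + ε) / 3) :=
  fun hlt => absurd (volume_ratio_law hε hC hV hlt) (not_lt.2 hD)

/-- **Payoff of the census conjecture (V2).**  If `|H₁| |H₂| |H₃| ≤ 2 · dim F_k|_{GL_m(𝔽_p)}` then the triple is
no witness of `SubgroupIdentityDesigns` at any `0 ≤ ε ≤ 1/4` once `dim F_k ≥ 8`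
(`(2+ε) log 2 ≤ 3(1−ε) log 2 = (1−ε) log 8 ≤ (1−ε) log D_k` iff `4ε ≤ 1`). [folklore] -/
theorem no_witness_of_volume_le_two_mul {ε : ℝ} (hε : 0 ≤ ε) (hε4 : ε ≤ 1 / 4)
    {H₁ H₂ H₃ : Subgroup (GLm p m)}
    (hV : ((Nat.card H₁ * Nat.card H₂ * Nat.card H₃ : ℕ) : ℝ) ≤ 2 * (finrank ℂ (levelSubmodule p m k) : ℝ))
    (hD : (8 : ℝ) ≤ (finrank ℂ (levelSubmodule p m k) : ℝ)) :
    ¬ budget p m k (2 + ε) <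
      ((Nat.card H₁ * Nat.card H₂ * Nat.card H₃ : ℕ) : ℝ) ^ ((2 + ε) / 3) := by
  refine no_witness_of_volume_le_mul hε two_pos hV ?_
  have hlog2 : 0 < Real.log 2 := Real.log_pos one_lt_two
  have h8 : Real.log 8 = 3 * Real.log 2 := by
    rw [show (8 : ℝ) = 2 ^ 3 by norm_num, Real.log_pow]; norm_num
  have hD' : Real.log 8 ≤ Real.log (finrank ℂ (levelSubmodule p m k) : ℝ) :=
    Real.log_le_log (by norm_num) hD
  have h1e : 0 ≤ 1 - ε := by linarith
  calc (2 + ε) * Real.log 2 ≤ (1 - ε) * (3 * Real.log 2) := by nlinarith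
    _ = (1 - ε) * Real.log 8 := by rw [h8]
    _ ≤ (1 - ε) * Real.log (finrank ℂ (levelSubmodule p m k) : ℝ) := mul_le_mul_of_nonneg_left hD' h1e

end Crux

end VolumeRatioLaw
end Summit.MatrixMultiplication.MatrixMultiplication.Theorems.SubgroupIdentityDesigns.Negative

end
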